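import Literature.NumberTheory.Automorphic.CuspidalCohomologyGLRankOneProofs
import HarnessLib

/-!
# `H⁰`-eigenclasses of the arithmetic quotients are eigenfunctions; eigenfunctions of a generating
# set of translations are characters

Topic `NumberTheory/Automorphic`; proof file (theorems only: no definition, no named fact, no
instance), sequel to `CuspidalCohomologyGLRankOneProofs` (there: invariant eigenFUNCTIONS give
eigenCLASSES in `H⁰(Γ, Fun(𝒢 ⧸ L, V))`, `TwistedQuotient.exists_eigenclass_H0`).  Here the converse
bookkeeping, used by the rank-one case of the named fact
`GLnCohomology.interiorEigenclass_isCuspidal` (`CuspidalCohomologyGL`; every Hecke eigenclass in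
`H^{b_n}_!` comes from a cuspidal automorphic representation):

* `TwistedQuotient.exists_invariant_fun_of_H0` — a class `x ∈ H⁰(Γ, Fun(𝒢 ⧸ L, V))` IS an
  invariant function `f` (Mathlib `groupCohomology.H0Iso`), `x = 0 ↔ f = 0`, and
  `T_g x = c x ↔ [L g L] f = c f` (naturality of `H0Iso`, `groupCohomology.map_id_comp_H0Iso_hom`).
* `ArithmeticQuotient.exists_character_of_eigen_generators` — for a group `𝒢` and a field `k`:
  if a non-zero `f : 𝒢 ⧸ L → V` is an eigenfunction of the translations by the elements of a set
  `T` which generates `𝒢` (`f(c g) = s_g f(c)` for all `c`, `g ∈ T`), then the translations `g`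
  under which `f` is an eigenfunction form a subgroup (inverses because `s_g ≠ 0` for `f ≠ 0`),
  which is therefore everything, and the (unique) eigenvalues form a character `χ : 𝒢 → kˣ` with
  `f(c g) = χ(g) f(c)` — the elementary step "a Hecke eigenform on `GL₁` is a multiple of a
  quasi-character" (Gelbart (1975), §2.A).

## References

* S. Gelbart, *Automorphic forms on adele groups*, Ann. of Math. Stud. 83 (1975), §2.A
  [Gelbart1975].
* G. Shimura, *Introduction to the arithmetic theory of automorphic functions* (1971), Ch. 3,
  §3.1 [ShimuraIATAF1971].
-/

noncomputable section

open CategoryTheory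
open scoped Classical

universe u

namespace Literature.NumberTheory.Automorphic

/-! ### `H⁰`-classes are invariant functions, compatibly with the Hecke operators -/

namespace TwistedQuotient

open groupCohomology

variable {k : Type u} [CommRing k] {Γ 𝒢 : Type u} [Group Γ] [Group 𝒢]
variable (ι : Γ →* 𝒢) (L : Subgroup 𝒢) {V : Type u} [AddCommGroup V] [Module k V]
  (ρ : Representation k Γ V)

/-- **Classes in `H⁰` are invariant functions.**  Every `x ∈ H⁰(Γ, Fun(𝒢 ⧸ L, V))` is (the class
of) a function `f : 𝒢 ⧸ L → V` invariant under the twisted action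
(`(γ • f)(c) = ρ(γ) f(ι(γ)⁻¹ c)`), with `f = 0 ↔ x = 0`, and the Hecke operator `T_g = [L g L]` acts
on `x` by the scalar `c` iff the double-coset operator `heckeFun` acts on `f` by `c` (Mathlib
`groupCohomology.H0Iso` and its naturality `map_id_comp_H0Iso_hom`). [folklore] -/
theorem exists_invariant_fun_of_H0 (x : cohomology ι L ρ 0) :
    ∃ f : (𝒢 ⧸ L) → V, (∀ γ : Γ, coeffRepresentation ι L ρ γ f = f) ∧ (f = 0 ↔ x = 0) ∧
      ∀ (g : 𝒢) (c : k), heckeEnd ι L ρ g 0 x = c • x ↔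
        ArithmeticQuotient.heckeFun k L g V f = c • f := by
  set A : Rep k Γ := coeffRep ι L ρ with hA
  set y : A.ρ.invariants := (H0Iso A).hom x with hy
  have hinj : Function.Injective (H0Iso A).hom := (H0Iso A).toLinearEquiv.injective
  have hnat : ∀ g : 𝒢, ((H0Iso A).hom (heckeEnd ι L ρ g 0 x) : A.ρ.invariants).1 =
      ArithmeticQuotient.heckeFun k L g V y.1 := fun g => by
    change ((H0Iso A).hom ((groupCohomology.map (MonoidHom.id Γ) (heckeRepHom ι L ρ g) 0) x)).1 = _
    rw [map_id_comp_H0Iso_hom_apply]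
    rfl
  refine ⟨y.1, fun γ => y.2 γ, ⟨fun h => ?_, fun h => ?_⟩, fun g c => ⟨fun h => ?_, fun h => ?_⟩⟩
  · have : y = 0 := Subtype.ext h
    apply hinj
    rw [← hy, this, map_zero]
  · rw [hy, h, map_zero]
    rfl
  · have h2 := congrArg (fun z => ((H0Iso A).hom z : A.ρ.invariants).1) h
    simp only at h2
    rw [hnat, map_smul] at h2
    exact h2
  · apply hinj
    refine Subtype.ext ?_
    rw [hnat, h, map_smul]
    rfl

end TwistedQuotient

/-! ### Eigenfunctions of a generating set of translations are characters -/

namespace ArithmeticQuotient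

variable {k : Type u} [Field k] {𝒢 : Type u} [Group 𝒢]

/-- **Eigenfunctions of generating translations are characters.**  Let `𝒢` be a group (in the
application commutative), `L ≤ 𝒢`, `k` a field and `f : 𝒢 ⧸ L → V` a NON-ZERO function which, for every `g` in a subset
`T ⊆ 𝒢` generating `𝒢` (no proper subgroup contains `T`), is an eigenfunction of translation by
`g`: `f(c g) = s_g f(c)` for all `c`.  Then there is a unique character `χ : 𝒢 → kˣ` with
`f(c g) = χ(g) f(c)` for ALL `g, c`, and `χ(g)` is the only scalar with this property.  (The `g`
admitting such a scalar form a subgroup — products multiply the scalars, and `s_g ≠ 0` since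
`f ≠ 0` and `c ↦ c g` is onto, so `g⁻¹` has the scalar `s_g⁻¹` —, hence all of `𝒢`; the scalar of
`g` is unique because `f ≠ 0`, so `g ↦ s_g` is multiplicative.)  This is the step "a Hecke
eigenfunction on `GL₁(ℚ) \ GL₁(𝔸_f) / K_f` is a multiple of a character" of the dictionary between
automorphic forms on `GL(1)` and Grössencharacters (Gelbart (1975), §2.A). [cite: Gelbart1975, §2.A] -/
theorem exists_character_of_eigen_generators
    (L : Subgroup 𝒢) {V : Type u} [AddCommGroup V] [Module k V] (f : (𝒢 ⧸ L) → V) (hf0 : f ≠ 0)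
    (T : Set 𝒢) (hT : ∀ g ∈ T, ∃ s : k, ∀ c : 𝒢, f ((c * g : 𝒢) : 𝒢 ⧸ L) = s • f (c : 𝒢 ⧸ L))
    (hgen : ∀ S : Subgroup 𝒢, T ⊆ S → S = ⊤) :
    ∃ χ : 𝒢 →* kˣ,
      (∀ (g c : 𝒢), f ((c * g : 𝒢) : 𝒢 ⧸ L) = ((χ g : kˣ) : k) • f (c : 𝒢 ⧸ L)) ∧
      ∀ (g : 𝒢) (s : k), (∀ c : 𝒢, f ((c * g : 𝒢) : 𝒢 ⧸ L) = s • f (c : 𝒢 ⧸ L)) →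
        s = ((χ g : kˣ) : k) := by
  -- a point where `f ≠ 0`
  obtain ⟨c₀, hc₀⟩ : ∃ c₀ : 𝒢, f (c₀ : 𝒢 ⧸ L) ≠ 0 := by
    by_contra h
    push Not at h
    exact hf0 (funext fun q => QuotientGroup.induction_on q fun c => by rw [h c, Pi.zero_apply])
  -- the scalar of a translation is unique and non-zero
  have huniq : ∀ (g : 𝒢) (s s' : k), (∀ c : 𝒢, f ((c * g : 𝒢) : 𝒢 ⧸ L) = s • f (c : 𝒢 ⧸ L)) →
      (∀ c : 𝒢, f ((c * g : 𝒢) : 𝒢 ⧸ L) = s' • f (c : 𝒢 ⧸ L)) → s = s' := by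
    intro g s s' hs hs'
    by_contra hne
    have h1 : (s - s') • f (c₀ : 𝒢 ⧸ L) = 0 := by rw [sub_smul, ← hs, ← hs', sub_self]
    apply hc₀
    have h2 : f (c₀ : 𝒢 ⧸ L) = (s - s')⁻¹ • ((s - s') • f (c₀ : 𝒢 ⧸ L)) := by
      rw [smul_smul, inv_mul_cancel₀ (sub_ne_zero.2 hne), one_smul]
    rw [h2, h1, smul_zero]
  have hne0 : ∀ (g : 𝒢) (s : k), (∀ c : 𝒢, f ((c * g : 𝒢) : 𝒢 ⧸ L) = s • f (c : 𝒢 ⧸ L)) →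
      s ≠ 0 := by
    intro g s hs h0
    apply hc₀
    have h := hs (c₀ * g⁻¹)
    rwa [inv_mul_cancel_right, h0, zero_smul] at h
  -- the subgroup of eigen-translations is everything
  let E : Subgroup 𝒢 :=
    { carrier := {g | ∃ s : k, ∀ c : 𝒢, f ((c * g : 𝒢) : 𝒢 ⧸ L) = s • f (c : 𝒢 ⧸ L)}
      one_mem' := ⟨1, fun c => by rw [mul_one, one_smul]⟩
      mul_mem' := by
        rintro g h ⟨s, hs⟩ ⟨t, ht⟩
        exact ⟨t * s, fun c => by rw [← mul_assoc, ht, hs, smul_smul]⟩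
      inv_mem' := by
        rintro g ⟨s, hs⟩
        refine ⟨s⁻¹, fun c => ?_⟩
        have h := hs (c * g⁻¹)
        rw [inv_mul_cancel_right] at h
        rw [h, smul_smul, inv_mul_cancel₀ (hne0 g s hs), one_smul] }
  have hE : E = ⊤ := hgen E fun g hg => hT g hg
  have hall : ∀ g : 𝒢, ∃ s : k, ∀ c : 𝒢, f ((c * g : 𝒢) : 𝒢 ⧸ L) = s • f (c : 𝒢 ⧸ L) := fun g => by
    have hg : g ∈ E := hE ▸ Subgroup.mem_top g
    exact hg
  choose s hs using hall
  -- the character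
  let χ : 𝒢 →* kˣ :=
    { toFun := fun g => Units.mk0 (s g) (hne0 g (s g) (hs g))
      map_one' := Units.ext (by
        rw [Units.val_mk0, Units.val_one]
        exact huniq 1 _ _ (hs 1) fun c => by rw [mul_one, one_smul])
      map_mul' := fun g h => Units.ext (by
        rw [Units.val_mk0, Units.val_mul, Units.val_mk0, Units.val_mk0]
        refine huniq (g * h) _ _ (hs (g * h)) fun c => ?_
        rw [← mul_assoc, hs h, hs g, smul_smul, mul_comm]) }
  refine ⟨χ, fun g c => ?_, fun g t ht => ?_⟩
  · change f ((c * g : 𝒢) : 𝒢 ⧸ L) = ((Units.mk0 (s g) (hne0 g (s g) (hs g)) : kˣ) : k) • f (c : 𝒢 ⧸ L)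
    rw [Units.val_mk0]
    exact hs g c
  · change t = ((Units.mk0 (s g) (hne0 g (s g) (hs g)) : kˣ) : k)
    rw [Units.val_mk0]
    exact huniq g _ _ ht (hs g)

end ArithmeticQuotient

end Literature.NumberTheory.Automorphic
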